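import Summits.Ventures.HodgeRepro2.T5SU11ResolventGroundStateTransformIterates
import Summits.Ventures.HodgeRepro2.T5SU11ResolventL1GroundStateNeumann
import Summits.Ventures.HodgeRepro2.T5SU11WeightedSpaceGroundStateClass
import Summits.Ventures.HodgeRepro2.T5SU11KernelDerivative

/-!
# Summary XX — the ground-state transform of the iterates, the `L¹(Ξ sinh)` Neumann series, the class at rate `≥ 1` in
`W_1`, and the derivative of the kernel (rows 572–575), under uniform names

Throughout `μ = λ(λ − 2)`, `Ξ = φ_1`, `W_1 = {g continuous on (0, ∞) : |g| ≤ D Ξ}`, `K_λ` the kernel of `G^I_λ`.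

* `transform_iterate_ground`, `transform_neumann_geometric` — **`∫ ((G^I_λ)ⁿ g) Ξ sinh 2t = (−1)ⁿ (∫ g Ξ sinh 2s)/((λ − 1)²)ⁿ`**
  and the transformed Neumann series sums to `−T/(λ − 1)²` (row 572);
* `l1_iterates_ground`, `neumann_remainder_l1_ground`, `neumann_l1_ground` — **the Neumann series converges in
  `L¹(Ξ sinh 2t dt)` on the sharp disc** (row 573);
* `exp_neg_le_ground`, `class_mem_ground` — **every source of the class at a rate `ε ≥ 1` lies in `W_1`** (row 574);
* `kernel_source_mem_ground`, `kernel_comp_eq_resolvent`, `kernel_hasDerivAt_lam`, `kernel_deriv_lam`,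
  `kernel_continuousAt_lam`, `kernel_hasDerivAt_mu` — **`∂_μ K_μ(t, s) = (K_μ ∘ K_μ)(t, s)`**: the kernel is differentiable
  in the spectral parameter (row 575).

Nothing is claimed about (N).

Blind lane: Mathlib + the HodgeRepro2 prefix only; no sorry; axioms ⊆ {propext, Classical.choice,
Quot.sound}.
-/

namespace Summit.Ventures.HodgeRepro2.T5SU11RadialSummaryXX

open Filter Topology MeasureTheory
open Set (Ioi Ioc)
open T5SU11Cartan T5SU11SphericalFunction T5SU11SphericalDecay T5SU11RadialGreenImproper T5SU11RadialGreenKernel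
  T5SU11ResolventGroundStateTransformIterates T5SU11ResolventL1GroundStateNeumann
  T5SU11WeightedSpaceGroundStateClass T5SU11KernelDerivative

section measure

variable [MeasurableSpace Circle] [BorelSpace Circle]

omit [MeasurableSpace Circle] [BorelSpace Circle] in
/-- **The transformed Neumann series is geometric** (row 572). -/
theorem transform_neumann_geometric {lam lam₂ : ℝ} (hlam : 1 < lam) (hlam₂ : 1 < lam₂)
    (hq : |lam * (lam - 2) - lam₂ * (lam₂ - 2)| < (lam₂ - 1) ^ 2) (T : ℝ) :
    ∑' k : ℕ, (lam * (lam - 2) - lam₂ * (lam₂ - 2)) ^ k * ((-1 : ℝ) ^ (k + 1) * T / ((lam₂ - 1) ^ 2) ^ (k + 1))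
      = -T / (lam - 1) ^ 2 :=
  tsum_transform_neumann hlam hlam₂ hq T

/-- `e^{−εs} ≤ 8 Ξ(s)` for `s ≥ 0`, `ε ≥ 1` (row 574). -/
theorem exp_neg_le_ground {ε s : ℝ} (hε : 1 ≤ ε) (hs : 0 ≤ s) : Real.exp (-ε * s) ≤ 8 * sph 1 (hyp s) :=
  exp_neg_le_mul_sph_one hε hs

/-- **The class at a rate `≥ 1` lies in `W_1`** (row 574). -/
theorem class_mem_ground {g : ℝ → ℝ} (hg : ContinuousOn g (Ioi 0))
    {M : ℝ} (hM : ∀ s ∈ Ioc (0 : ℝ) 1, |g s| ≤ M) {ε C s₀ : ℝ} (hε : 1 ≤ ε)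
    (hC : ∀ s, s₀ ≤ s → |g s| ≤ C * Real.exp (-ε * s)) :
    ∃ D : ℝ, 0 ≤ D ∧ ∀ s, 0 < s → |g s| ≤ D * sph 1 (hyp s) :=
  exists_le_mul_sph_one_of_class hg hM hε hC

variable {lam : ℝ} (hlam : 1 < lam) {g : ℝ → ℝ} (hg : ContinuousOn g (Ioi 0))
  {M : ℝ} (hM : ∀ s ∈ Ioc (0 : ℝ) 1, |g s| ≤ M) (hM0 : 0 ≤ M)
  {ε C s₀ : ℝ} (hε : 2 - lam < ε) (hC : ∀ s, s₀ ≤ s → |g s| ≤ C * Real.exp (-ε * s))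
  (hg1 : IntegrableOn (fun s => |g s| * sph 1 (hyp s) * Real.sinh (2 * s)) (Ioi 0))

include hlam hg hM hM0 hε hC hg1 in
/-- **The ground-state transform of the iterates** (row 572). -/
theorem transform_iterate_ground (n : ℕ) :
    IntegrableOn (fun s => |((greenSolI (fun t => sph lam (hyp t)) (sphDecay lam))^[n] g) s| * sph 1 (hyp s)
      * Real.sinh (2 * s)) (Ioi 0) ∧
    ∫ t in Ioi 0, ((greenSolI (fun t => sph lam (hyp t)) (sphDecay lam))^[n] g) t * sph 1 (hyp t) * Real.sinh (2 * t)
      = (-1 : ℝ) ^ n * (∫ s in Ioi 0, g s * sph 1 (hyp s) * Real.sinh (2 * s)) / ((lam - 1) ^ 2) ^ n :=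
  iterate_transform_ground hlam hg hM hM0 hε hC hg1 n

include hlam hg hM hM0 hε hC hg1 in
/-- **The iterates in `L¹(Ξ sinh 2t dt)`** (row 573). -/
theorem l1_iterates_ground (n : ℕ) :
    ∫ t in Ioi 0, |((greenSolI (fun t => sph lam (hyp t)) (sphDecay lam))^[n] g) t| * sph 1 (hyp t) * Real.sinh (2 * t)
      ≤ (∫ s in Ioi 0, |g s| * sph 1 (hyp s) * Real.sinh (2 * s)) / ((lam - 1) ^ 2) ^ n :=
  iterate_l1_ground hlam hg hM hM0 hε hC hg1 n

include hlam hg hM hM0 hε hC hg1 in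
/-- **The `L¹(Ξ sinh 2t dt)` bound of the Neumann remainder** (row 573). -/
theorem neumann_remainder_l1_ground {lam₂ : ℝ} (hlam₂ : 1 < lam₂) (hε₂ : 2 - lam₂ < ε) (n : ℕ) :
    ∫ t in Ioi 0, |greenSolI (fun t => sph lam (hyp t)) (sphDecay lam) g t
        - ∑ k ∈ Finset.range (n + 1), (lam * (lam - 2) - lam₂ * (lam₂ - 2)) ^ k
          * (greenSolI (fun t => sph lam₂ (hyp t)) (sphDecay lam₂))^[k + 1] g t| * sph 1 (hyp t) * Real.sinh (2 * t)
      ≤ (|lam * (lam - 2) - lam₂ * (lam₂ - 2)| / (lam₂ - 1) ^ 2) ^ (n + 1)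
          * ((∫ s in Ioi 0, |g s| * sph 1 (hyp s) * Real.sinh (2 * s)) / (lam - 1) ^ 2) :=
  integral_abs_neumann_remainder_ground hlam hg hM hM0 hε hC hg1 hlam₂ hε₂ n

include hlam hg hM hM0 hε hC hg1 in
/-- **The Neumann series converges in `L¹(Ξ sinh 2t dt)` on the sharp disc** (row 573). -/
theorem neumann_l1_ground {lam₂ : ℝ} (hlam₂ : 1 < lam₂) (hε₂ : 2 - lam₂ < ε)
    (hq : |lam * (lam - 2) - lam₂ * (lam₂ - 2)| < (lam₂ - 1) ^ 2) :
    Tendsto (fun n : ℕ => ∫ t in Ioi 0, |greenSolI (fun t => sph lam (hyp t)) (sphDecay lam) g t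
        - ∑ k ∈ Finset.range (n + 1), (lam * (lam - 2) - lam₂ * (lam₂ - 2)) ^ k
          * (greenSolI (fun t => sph lam₂ (hyp t)) (sphDecay lam₂))^[k + 1] g t| * sph 1 (hyp t) * Real.sinh (2 * t))
      atTop (𝓝 0) :=
  tendsto_neumann_l1_ground hlam hg hM hM0 hε hC hg1 hlam₂ hε₂ hq

include hlam in
/-- **The kernel source `r ↦ K_λ(r, s)` lies in `W_1`** (row 575). -/
theorem kernel_source_mem_ground {s : ℝ} (hs : 0 < s) :
    ∃ D : ℝ, 0 ≤ D ∧ ∀ r, 0 < r → |sphGreenKernel lam r s| ≤ D * sph 1 (hyp r) :=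
  kernel_source_mem_weighted_one hlam hs

include hlam in
/-- **`G^I_λ K_λ(·, s)(t) = (K_λ ∘ K_λ)(t, s)`** (row 575). -/
theorem kernel_comp_eq_resolvent {s : ℝ} (hs : 0 < s) {t : ℝ} (ht : 0 < t) :
    greenSolI (fun t => sph lam (hyp t)) (sphDecay lam) (fun r => sphGreenKernel lam r s) t
      = ∫ r in Ioi 0, sphGreenKernel lam t r * sphGreenKernel lam r s * Real.sinh (2 * r) :=
  greenSolI_kernel_source_eq_integral hlam hs ht

include hlam in
/-- **The derivative of the kernel in `λ`**: `(2λ − 2) · (K_λ ∘ K_λ)(t, s)` (row 575). -/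
theorem kernel_hasDerivAt_lam {s : ℝ} (hs : 0 < s) {t : ℝ} (ht : 0 < t) :
    HasDerivAt (fun l => sphGreenKernel l t s)
      ((2 * lam - 2) * ∫ r in Ioi 0, sphGreenKernel lam t r * sphGreenKernel lam r s * Real.sinh (2 * r)) lam :=
  hasDerivAt_sphGreenKernel_lam hlam hs ht

include hlam in
/-- **`deriv (λ ↦ K_λ(t, s)) λ = (2λ − 2) · (K_λ ∘ K_λ)(t, s)`** (row 575). -/
theorem kernel_deriv_lam {s : ℝ} (hs : 0 < s) {t : ℝ} (ht : 0 < t) :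
    deriv (fun l => sphGreenKernel l t s) lam
      = (2 * lam - 2) * ∫ r in Ioi 0, sphGreenKernel lam t r * sphGreenKernel lam r s * Real.sinh (2 * r) :=
  deriv_sphGreenKernel_lam hlam hs ht

include hlam in
/-- **The kernel is continuous in the spectral parameter** (row 575). -/
theorem kernel_continuousAt_lam {s : ℝ} (hs : 0 < s) {t : ℝ} (ht : 0 < t) :
    ContinuousAt (fun l => sphGreenKernel l t s) lam :=
  continuousAt_sphGreenKernel_lam hlam hs ht

include hlam in
/-- **`∂_μ K_μ(t, s) = (K_μ ∘ K_μ)(t, s)`** (row 575). -/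
theorem kernel_hasDerivAt_mu {s : ℝ} (hs : 0 < s) {t : ℝ} (ht : 0 < t) :
    HasDerivAt (fun μ => sphGreenKernel (1 + Real.sqrt (μ + 1)) t s)
      (∫ r in Ioi 0, sphGreenKernel lam t r * sphGreenKernel lam r s * Real.sinh (2 * r)) (lam * (lam - 2)) :=
  hasDerivAt_sphGreenKernel_mu hlam hs ht

end measure

end Summit.Ventures.HodgeRepro2.T5SU11RadialSummaryXX
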